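import Literature.AlgebraicGeometry.FormalGeometry.WittGEPushforwardComparison
import Literature.AlgebraicGeometry.FormalGeometry.WittGEIsogenyTransfer
import Literature.AlgebraicGeometry.FormalGeometry.WittGEPullbackUnitSections
import Literature.AlgebraicGeometry.Morphisms.FormalModulePullback
import Literature.AlgebraicGeometry.Modules.IsoOfSectionsOnBasis
import HarnessLib

/-!
# The unit `𝒪/aⁿ⁺¹ → ρ_*ρ^*(𝒪/aⁿ⁺¹)` is an `a`-power isogeny when `ρ_*𝒪_{X'} = 𝒪_X`

Helper file toward the crux `PadicSemiregularLift.FormalVectorBundlesAlgebraize`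
(stmt-HodgeConjecture-14106), proper case via a Chow cover. Let `ρ : X' → X` be proper, `X` locally
noetherian and quasi-compact, with `ρ♯ : 𝒪_X(U) → 𝒪_{X'}(ρ⁻¹U)` bijective for every open `U`
(a birational proper morphism onto a normal scheme; for us a Chow cover of a smooth proper
`W(k)`-model, `…AlgebraizeChowCoverNormal`). For a global function `a` and the quotient
`Q_n = 𝒪_X/aⁿ⁺¹` (the `n`-th level `cmplObj a 𝒪_X n` of the completion tower) the unit
`η : Q_n → ρ_*ρ^*Q_n` of `ρ^* ⊣ ρ_*` identifies, up to the isomorphisms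
`Q_n ≅ (ρ_*𝒪_{X'})/aⁿ⁺¹` (from `ρ♯`) and `ρ_*ρ^*Q_n ≅ ρ_*(𝒪_{X'}/a'ⁿ⁺¹)` (`ρ^*` is right exact,
`ρ^*𝒪_X = 𝒪_{X'}`), with the push–pull comparison `v_n : (ρ_*𝒪_{X'})/aⁿ⁺¹ → ρ_*(𝒪_{X'}/a'ⁿ⁺¹)` of
`…AlgebraizePushforwardComparison` (`unit_cmplObj_eq`). Hence (the theorem on formal functions in
degree `0` for `𝒪_{X'}`, uniformly in `n`):

* `exists_unit_cmplObj_unit_torsion` — **there are `c₁ c₂` such that for every `n` the unit of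
  `𝒪_X/aⁿ⁺¹` has kernel killed by `a^c₁` and cokernel killed by `a^c₂`** (generalized-element form).

Everything is proved; no definitions.

Provenance: Literature home (family `hodge`, layer `Literature/AlgebraicGeometry/FormalGeometry`, namespace
`Literature.AlgebraicGeometry.FormalGeometry.WittGrothendieckExistence…`) of the Summits-side
`Theorems/PadicSemiregularLiftFormalVectorBundlesAlgebraizeUnitComparisonStructureSheaf` (route `PadicSemiregularLift` / `AnchorTransport`,
Grothendieck existence for vector bundles over `W(k)`), which `Literature/` may not import; theorems only, no
named fact, no definition. Lane `lit-hodgefound`, seat p20.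
-/

noncomputable section

-- `TopCat.Presheaf`/`Scheme.Modules` are not reducible (as in Mathlib's `AlgebraicGeometry/Modules`).
set_option backward.isDefEq.respectTransparency false

open CategoryTheory CategoryTheory.Limits _root_.AlgebraicGeometry TopologicalSpace Opposite
open Literature.AlgebraicGeometry.Modules Literature.AlgebraicGeometry.Morphisms
open Literature.AlgebraicGeometry.KTheory

universe u

namespace Literature.AlgebraicGeometry.FormalGeometry.WittGrothendieckExistence.FormalVectorBundlesAlgebraize

variable {X' X : Scheme.{u}} (ρ : X' ⟶ X) (a : Γ(X, ⊤))

/-! ### `𝒪_X ≅ ρ_* 𝒪_{X'}` from `ρ♯` -/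

/-- The comparison `j : 𝒪_X → ρ_*𝒪_{X'}` (unit of `ρ^* ⊣ ρ_*` followed by `ρ_*(ρ^*𝒪_X ≅ 𝒪_{X'})`) is
`ρ♯` on sections, hence an isomorphism when every `ρ♯_U` is bijective. [cite: GortzWedhorn2023, proof of Thm. 24.94 and Prop. 24.95 (pp. 566–567), auxiliary step] -/
theorem isIso_unitComparison (hρ : ∀ U : X.Opens, Function.Bijective (ρ.app U)) :
    IsIso (((Scheme.Modules.pullbackPushforwardAdjunction ρ).unit.app
        (SheafOfModules.unit X.ringCatSheaf)) ≫
      (Scheme.Modules.pushforward ρ).map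
        (show ((Scheme.Modules.pullback ρ).obj (SheafOfModules.unit X.ringCatSheaf) : X'.Modules) ⟶
            (SheafOfModules.unit X'.ringCatSheaf : X'.Modules) from
          SheafOfModules.pullbackObjUnitToUnit ρ.toRingCatSheafHom)) := by
  refine isIso_of_bijective_app_of_isAffineOpen _ fun V _ => ?_
  have e : ∀ x : Γ((SheafOfModules.unit X.ringCatSheaf : X.Modules), V),
      ((((Scheme.Modules.pullbackPushforwardAdjunction ρ).unit.app
          (SheafOfModules.unit X.ringCatSheaf)) ≫ (Scheme.Modules.pushforward ρ).map
          (show ((Scheme.Modules.pullback ρ).obj (SheafOfModules.unit X.ringCatSheaf) : X'.Modules) ⟶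
              (SheafOfModules.unit X'.ringCatSheaf : X'.Modules) from
            SheafOfModules.pullbackObjUnitToUnit ρ.toRingCatSheafHom)).app V x : Γ(X', ρ ⁻¹ᵁ V)) =
        ρ.app V x :=
    fun x => unit_app_unit_apply ρ V x
  exact ⟨fun x y hxy => (hρ V).1 (by rw [← e, ← e]; exact hxy), fun z => by
    obtain ⟨x, hx⟩ := (hρ V).2 z; exact ⟨x, (e x).trans hx⟩⟩

/-! ### The unit of `𝒪/aⁿ⁺¹` and the push–pull comparison of `𝒪_{X'}` -/

section Unit

variable [IsProper ρ] [IsLocallyNoetherian X] [CompactSpace X]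

/-- **The unit of `𝒪_X/aⁿ⁺¹` is an `a`-power isogeny, uniformly in `n`**, when `ρ : X' → X` is proper
with `ρ♯` bijective on all opens (`X` locally noetherian and quasi-compact): there are `c₁`, `c₂` with,
for every `n`, the kernel of `η : 𝒪/aⁿ⁺¹ → ρ_*ρ^*(𝒪/aⁿ⁺¹)` killed by `a^c₁` and its cokernel killed by
`a^c₂` (generalized-element form). [cite: GortzWedhorn2023, proof of Thm. 24.94 and Prop. 24.95 (pp. 566–567), auxiliary step] -/
theorem exists_unit_cmplObj_unit_torsion (hρ : ∀ U : X.Opens, Function.Bijective (ρ.app U)) :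
    ∃ c₁ c₂ : ℕ, ∀ n : ℕ,
      (∀ {T : X.Modules} (z : T ⟶ cmplObj a (SheafOfModules.unit X.ringCatSheaf) n),
        z ≫ (Scheme.Modules.pullbackPushforwardAdjunction ρ).unit.app _ = 0 →
          z ≫ globalScalar _ (a ^ c₁) = 0) ∧
      (∀ {T : X.Modules} (q : (Scheme.Modules.pullback ρ ⋙ Scheme.Modules.pushforward ρ).obj
          (cmplObj a (SheafOfModules.unit X.ringCatSheaf) n) ⟶ T),
        (Scheme.Modules.pullbackPushforwardAdjunction ρ).unit.app _ ≫ q = 0 →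
          globalScalar _ (a ^ c₂) ≫ q = 0) := by
  haveI : IsLocallyNoetherian X' := LocallyOfFiniteType.isLocallyNoetherian ρ
  -- notation
  let O : X.Modules := SheafOfModules.unit X.ringCatSheaf
  let O' : X'.Modules := SheafOfModules.unit X'.ringCatSheaf
  let η := (Scheme.Modules.pullbackPushforwardAdjunction ρ).unit
  let pOU : (Scheme.Modules.pullback ρ).obj O ⟶ O' :=
    show ((Scheme.Modules.pullback ρ).obj (SheafOfModules.unit X.ringCatSheaf) : X'.Modules) ⟶
        (SheafOfModules.unit X'.ringCatSheaf : X'.Modules) from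
      SheafOfModules.pullbackObjUnitToUnit ρ.toRingCatSheafHom
  haveI hpOU : IsIso pOU := isIso_pullbackObjUnitToUnit ρ
  let j : O ⟶ (Scheme.Modules.pushforward ρ).obj O' := η.app O ≫ (Scheme.Modules.pushforward ρ).map pOU
  haveI hj : IsIso j := isIso_unitComparison ρ hρ
  -- the push–pull comparison for `G = 𝒪_{X'}` and its uniform torsion bounds
  have hO' : Coh O' := ⟨IsAffineLocalizing.unit, IsAffineFiniteType.unit⟩
  obtain ⟨v, hv⟩ := exists_pushforwardCmplComparison ρ a O'
  obtain ⟨c₁, hc₁⟩ := pushforwardCmplComparison_kernel_torsion ρ a hO' v hv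
  obtain ⟨c₂, hc₂⟩ := pushforwardCmplComparison_cokernel_torsion ρ a hO' v hv
  refine ⟨c₁, c₂, fun n => ?_⟩
  -- the identification `η_Q ≫ ρ_*(κ) = cmplMapApp j ≫ v_n`
  let κ : (Scheme.Modules.pullback ρ).obj (cmplObj a O n) ⟶ cmplObj (ρ.appTop a) O' n :=
    (pullbackCmplObjIso ρ a O n).hom ≫ cmplMapApp (ρ.appTop a) pOU n
  haveI hκ : IsIso (cmplMapApp (ρ.appTop a) pOU n) :=
    ⟨cmplMapApp (ρ.appTop a) (inv pOU) n, by rw [← cmplMapApp_comp, IsIso.hom_inv_id, cmplMapApp_id],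
      by rw [← cmplMapApp_comp, IsIso.inv_hom_id, cmplMapApp_id]⟩
  haveI : IsIso κ := IsIso.comp_isIso
  have key : η.app (cmplObj a O n) ≫ (Scheme.Modules.pushforward ρ).map κ =
      cmplMapApp a j n ≫ v.app ⟨n⟩ := by
    rw [← cancel_epi (cmplπ a O n), cmplπ_cmplMapApp_assoc, hv n]
    have hnat : cmplπ a O n ≫ η.app (cmplObj a O n) = η.app O ≫
        (Scheme.Modules.pullback ρ ⋙ Scheme.Modules.pushforward ρ).map (cmplπ a O n) :=
      η.naturality (cmplπ a O n)
    rw [reassoc_of% hnat, ← Functor.map_comp]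
    change η.app O ≫ (Scheme.Modules.pushforward ρ).map
      (((Scheme.Modules.pullback ρ).map (cmplπ a O n) ≫ (pullbackCmplObjIso ρ a O n).hom) ≫
        cmplMapApp (ρ.appTop a) pOU n) = _
    rw [pullback_map_cmplπ_pullbackCmplObjIso_hom, cmplπ_cmplMapApp, Functor.map_comp,
      ← Category.assoc]
  -- `η_Q = (cmplMapApp j ≫ v_n) ≫ ρ_*(κ)⁻¹`
  have key' : η.app (cmplObj a O n) =
      (cmplMapApp a j n ≫ v.app ⟨n⟩) ≫ inv ((Scheme.Modules.pushforward ρ).map κ) := by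
    rw [← key, Category.assoc, IsIso.hom_inv_id, Category.comp_id]
  haveI : IsIso (cmplMapApp a j n) :=
    ⟨cmplMapApp a (inv j) n, by rw [← cmplMapApp_comp, IsIso.hom_inv_id, cmplMapApp_id],
      by rw [← cmplMapApp_comp, IsIso.inv_hom_id, cmplMapApp_id]⟩
  refine ⟨fun z hz => ?_, fun q hq => ?_⟩
  · -- kernel bound: transport the one of `v_n` along the isomorphisms
    change z ≫ η.app (cmplObj a O n) = 0 at hz
    rw [key'] at hz
    exact kerBound_mono_comp (fun Z : X.Modules => globalScalar Z (a ^ c₁))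
      (fun f => globalScalar_comp f _) (cmplMapApp a j n) _
      (fun z hz => kerBound_comp_mono (fun Z : X.Modules => globalScalar Z (a ^ c₁)) (v.app ⟨n⟩) _
        (fun z hz => kerBound_of_kernel_ι (a ^ c₁) (v.app ⟨n⟩) (hc₁ n) z hz) z hz) z
      (by simpa only [Category.assoc] using hz)
  · -- cokernel bound
    change η.app (cmplObj a O n) ≫ q = 0 at hq
    rw [key'] at hq
    exact cokerBound_comp_epi (fun Z : X.Modules => globalScalar Z (a ^ c₂))
      (fun f => globalScalar_comp f _) _ (inv ((Scheme.Modules.pushforward ρ).map κ))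
      (fun q hq => cokerBound_epi_comp (fun Z : X.Modules => globalScalar Z (a ^ c₂))
        (cmplMapApp a j n) (v.app ⟨n⟩)
        (fun q hq => cokerBound_of_cokernel_π (a ^ c₂) (v.app ⟨n⟩) (hc₂ n) q hq) q hq) q hq

end Unit

end Literature.AlgebraicGeometry.FormalGeometry.WittGrothendieckExistence.FormalVectorBundlesAlgebraize

end
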